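import Summits.HodgeConjecture.HodgeConjecture.Theorems.Ring2WeilCoverageLagrangianPairWindows
import HarnessLib

/-!
# Weil-type family coverage — THEOREM J4 (the Johnson windows `S^{(n−k,k)}` of all six carriers for general `k`, uniformly in `n`)
(ring2-b02, gen 73)

research route conditional on HC_CM; not a corollary; Q11.4-sentence-2 already refuted in dim ≥ 3.

Ring 2, WEIL-TYPE FAMILY-COVERAGE CENSUS (`HOME/WEIL-FAMILY-COVERAGE.md` `## b02 (g = 6)`, block b02.33, owner ring2-b02).
THEOREM J3 (block b02.32, file `Ring2WeilCoverageLagrangianPairWindows`) closed the windows `(G₁ × S_n|A_n, λ ⊠ S^{(n−k,k)})` of the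
six `g = 6` carriers for `k = 2, 3` and every `n` by a Lagrangian kernel bound with a HAND-WRITTEN quadratic / cubic kernel.  Block
b02.33 does every `k` with ONE closed-form kernel:

* LEMMA Q_k (exact identity).  `Fix_k(h:y) + T·n^{k−1}·u(y) = Σ_{m ∈ [c]^k} ℓ_{m_1}⋯ℓ_{m_k} · KER_h(ℓ_{m_1},…,ℓ_{m_k}; T, 1/n)`,
  `KER_h(x;T,ξ) = (T/k)Σ_a(1 − 1/x_a) + Σ_{q=1}^{k} ξ^{k−q} w_q Σ_{|A|=q} D_q(x_A)`, `w_q = 1/(q!·C(k,q))`, with `D_q` a finite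
  Möbius/character average of the composition constants of `log(1+z^d)` — exp-log of the fixed-subset generating function
  `∏_i (1+z^{ℓ_i/g_i})^{g_i}` of `y^t`, averaged over `t` (§1: the multiplier distributes into the `k`-linear form for every `k`;
  the degree-`k` budget polynomials `e_4`, `e_5`);
* LEMMA K_k.  `Fix_k + T n^{k−1} u ≤ n^k · Ψ_h(T, 1/n)`, `Ψ_h` the supremum of the kernel (§2);
* LEMMA R / T / T′.  The supremum is an EXACT finite maximum: scaling the top `p`-adic level of a tuple is affine in `p^{−t}`
  (§3 `affine_family_sup`), so maximisers are `P`-number tuples with chain-valid valuations (plus limits); the `ξ¹`-coefficient terms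
  through a large coordinate are non-positive (§3 `dkm1_nonpos`);
* THEOREM J4.  Riemann–Hurwitz + LEMMA K_k + `S_σ(1/n;T) > 0` exclude the budget (§4 `budget_exclusion_k`); for `n ≥ n₁` two endpoints
  of a concave minorant suffice (§4 `two_endpoints_of_concave`), for `n₀ ≤ n < n₁` the exact inequality is evaluated per `n`;
* LEMMA μ_k (ALL `k`).  `min_{g≠1} codim Fix(g | S^{(n−k,k)}) ≥ 7` for `n ≥ 9`, `3 ≤ k ≤ n/2` (§5: the two arithmetic steps of the
  induction; machine table `n ≤ 40`), hence the Euclidean signature `(3a)³` of `F₂₁` is excluded in EVERY Johnson window (§5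
  `tight_signature_all_k`);
* §6: the `ξ = 0` endpoint arithmetic of the worst certificates of record at `k = 4` and `k = 5` (`weilcov/g73/john/lagrk.py`, exact
  integer branch-and-bound; LEMMA Q_k verified against Young's rule on every cycle type `2k ≤ n ≤ 10`, `k ≤ 5`, 41 904 checks; the
  engine reproduces LEMMA Σ (`k = 2`) on 12 375 points and the cubic engine's exact values (`k = 3`)).

Thresholds of record (every signature; any number of branch points and pure slots; `S_n` and `A_n`): `k = 4`: `GL₂(3)` `n ≥ 15`,
`PSL₂(7)`, `G₂₄` `n ≥ 13`, `SD₁₆`, `F₂₁`, `PSL₂(11)` `n ≥ 12`; `k = 5`: all six `n ≥ 16`; with the scans (`n ≤ 50`, `k ≤ 5`) the windows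
`S^{(n−k,k)}`, `k ≤ 5`, of all six carriers are closed for every `n` (`k = 6` and the soundness cross-checks — LEMMA K_k on every cycle
type `n ≤ 16 / 18`, the certificates against the exact relaxation — are tabulated in the block).  Nothing in this file is a statement
about Hodge classes; `HC_CM` is used nowhere; no `def`, no named fact.
References: [cite: vanGeemen1994HodgeAV, 5.2 and (5.4.1)] (the Weil-type bookkeeping these windows feed); the symmetric-group facts
(Young's rule for two-row shapes, cycle index of a cyclic group) are classical and re-derived, not cited.
-/

noncomputable section

set_option linter.dupNamespace false

open Finset

namespace Summit.HodgeConjecture.HodgeConjecture.Ring2.WeilCoverage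

namespace LagrangianJohnsonWindows

/-! ### §1 LEMMA Q_k — the multiplier distributes into the `k`-linear form; the budget polynomials -/

/-- One summand of the multiplier distribution for general `k`: a cycle length `x ≠ 0` carries `x·(1 − 1/x) = x − 1`.
research route conditional on HC_CM; not a corollary; Q11.4-sentence-2 already refuted in dim ≥ 3. [folklore] -/
theorem multiplier_k_term (x : ℚ) (hx : x ≠ 0) : x * (1 - 1 / x) = x - 1 := by
  field_simp

/-- **The multiplier distributes into the `k`-linear form (every `k`).**  Over the cycles `i ∈ s` of `y` (lengths `ℓ i`) and the
`k`-tuples `m : Fin k → s` of cycles, marking one position `a`: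
`Σ_m (∏_{b ≠ a} ℓ(m b)) · (ℓ(m a) − 1) = (Σ_i ℓ_i)^{k−1} · Σ_i (ℓ_i − 1) = n^{k−1}·u(y)`;
summing over the `k` positions and dividing by `k` gives `T n^{k−1} u = T Σ_m ∏ℓ · (1/k)Σ_a (1 − 1/ℓ(m a))` (with `multiplier_k_term`).
research route conditional on HC_CM; not a corollary; Q11.4-sentence-2 already refuted in dim ≥ 3. [folklore] -/
theorem multiplier_k_distribution {ι : Type*} [DecidableEq ι] (s : Finset ι) (ℓ : ι → ℚ) (k : ℕ) (a : Fin k) :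
    ∑ m ∈ Fintype.piFinset (fun _ : Fin k => s), ∏ b, (if b = a then ℓ (m b) - 1 else ℓ (m b))
      = (∑ i ∈ s, ℓ i) ^ (k - 1) * ∑ i ∈ s, (ℓ i - 1) := by
  rw [← Finset.prod_univ_sum (fun _ : Fin k => s) (fun b i => if b = a then ℓ i - 1 else ℓ i)]
  rw [← Finset.mul_prod_erase Finset.univ _ (Finset.mem_univ a)]
  have ha : (∑ i ∈ s, if a = a then ℓ i - 1 else ℓ i) = ∑ i ∈ s, (ℓ i - 1) :=
    Finset.sum_congr rfl (fun i _ => if_pos rfl)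
  have h : ∀ b ∈ Finset.univ.erase a, (∑ i ∈ s, if b = a then ℓ i - 1 else ℓ i) = ∑ i ∈ s, ℓ i := fun b hb =>
    Finset.sum_congr rfl (fun i _ => if_neg (Finset.ne_of_mem_erase hb))
  rw [ha, Finset.prod_congr rfl h, Finset.prod_const, Finset.card_erase_of_mem (Finset.mem_univ a), Finset.card_univ,
    Fintype.card_fin, mul_comm]

/-- **The budget polynomial at `k = 4`:** `d_4 = C(n,4) − C(n,3) = n(n−1)(n−2)(n−7)/24`, i.e. `d_4/n⁴ = e_4(1/n)` with
`e_4(ξ) = 1/24 − 5ξ/12 + 23ξ²/24 − 7ξ³/12` — the kernel at the identity tuple `(1,1,1,1)` for a label with `e_h = 1`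
(`Fix_4(h : 1) = e_h d_4`).
research route conditional on HC_CM; not a corollary; Q11.4-sentence-2 already refuted in dim ≥ 3. [folklore] -/
theorem e4_kernel_at_identity (n : ℚ) (hn : n ≠ 0) :
    n ^ 4 * (1 / 24 - 5 / 12 * (1 / n) + 23 / 24 * (1 / n) ^ 2 - 7 / 12 * (1 / n) ^ 3)
      = n * (n - 1) * (n - 2) * (n - 3) / 24 - n * (n - 1) * (n - 2) / 6 ∧
    n * (n - 1) * (n - 2) * (n - 3) / 24 - n * (n - 1) * (n - 2) / 6 = n * (n - 1) * (n - 2) * (n - 7) / 24 := by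
  constructor
  · field_simp
    ring
  · ring

/-- **The budget polynomial at `k = 5`:** `d_5 = C(n,5) − C(n,4) = n(n−1)(n−2)(n−3)(n−9)/120 = n⁵ e_5(1/n)`,
`e_5(ξ) = 1/120 − ξ/8 + 13ξ²/24 − 7ξ³/8 + 9ξ⁴/20`.
research route conditional on HC_CM; not a corollary; Q11.4-sentence-2 already refuted in dim ≥ 3. [folklore] -/
theorem e5_kernel_at_identity (n : ℚ) (hn : n ≠ 0) :
    n ^ 5 * (1 / 120 - 1 / 8 * (1 / n) + 13 / 24 * (1 / n) ^ 2 - 7 / 8 * (1 / n) ^ 3 + 9 / 20 * (1 / n) ^ 4)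
      = n * (n - 1) * (n - 2) * (n - 3) * (n - 9) / 120 ∧
    n * (n - 1) * (n - 2) * (n - 3) * (n - 4) / 120 - n * (n - 1) * (n - 2) * (n - 3) / 24
      = n * (n - 1) * (n - 2) * (n - 3) * (n - 9) / 120 := by
  constructor
  · field_simp
    ring
  · ring

/-- The leading (`ξ = 0`) coefficient of the kernel is `k`-INDEPENDENT after rescaling: at `ξ = 0` only the multiplier and the top
term `s_h(lcm)/(k!·lcm)` survive, so `k!·KER_h(x;T,0) = s/L + (k!T/k)·Σ_a(1 − 1/x_a)`; on a homocyclic tuple `x = (L,…,L)` this is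
`s/L + k!·T·(1 − 1/L)` — the pair kernel of THEOREM J3 at `T' = k!T/2`, `ξ = 0` (there `K = s/L + T'(2 − 2/L)`).
research route conditional on HC_CM; not a corollary; Q11.4-sentence-2 already refuted in dim ≥ 3. [folklore] -/
theorem leading_coefficient_rescaling (s L T kf : ℚ) :
    s / L + kf * T * (1 - 1 / L) = s / L + (kf * T / 2) * (2 - 1 / L - 1 / L) := by ring

/-! ### §2 LEMMA K_k — the kernel supremum bounds the `k`-linear form -/

/-- **LEMMA K_k.**  A combination `Σ_m w_m K_m` with non-negative weights is at most `(Σ_m w_m)·Ψ` when every `K_m ≤ Ψ`; with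
`w_m = ℓ_{m_1}⋯ℓ_{m_k} ≥ 0`, `Σ_m w_m = n^k` and `K_m = KER_h(ℓ_m; T, 1/n) ≤ Ψ_h(T, 1/n)` this is
`Fix_k(h:y) + T n^{k−1} u(y) ≤ n^k Ψ_h(T, 1/n)`.
research route conditional on HC_CM; not a corollary; Q11.4-sentence-2 already refuted in dim ≥ 3. [folklore] -/
theorem kernel_sup_bound_k {ι : Type*} (s : Finset ι) (w K : ι → ℚ) (Ψ : ℚ) (hw : ∀ m ∈ s, 0 ≤ w m)
    (hK : ∀ m ∈ s, K m ≤ Ψ) : ∑ m ∈ s, w m * K m ≤ (∑ m ∈ s, w m) * Ψ := by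
  rw [Finset.sum_mul]
  exact Finset.sum_le_sum fun m hm => mul_le_mul_of_nonneg_left (hK m hm) (hw m hm)

/-- The kernel is `1`-Lipschitz and non-decreasing in the multiplier: `KER(x;T,ξ) = T·α(x) + κ_x(ξ)` with `0 ≤ α(x) ≤ 1`, so for
`T ≥ T₀` every kernel value, hence the supremum, satisfies `Ψ(T) ≤ Ψ(T₀) + (T − T₀)` — the engine's extension of a label table
beyond its cap `T₀`.
research route conditional on HC_CM; not a corollary; Q11.4-sentence-2 already refuted in dim ≥ 3. [folklore] -/
theorem lipschitz_extension (α κ T T₀ Ψ₀ : ℚ) (hα : α ≤ 1) (hT : T₀ ≤ T) (h0 : T₀ * α + κ ≤ Ψ₀) :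
    T * α + κ ≤ Ψ₀ + (T - T₀) := by
  nlinarith

/-! ### §3 LEMMA R, LEMMA T′ — the supremum is a finite maximum -/

/-- **LEMMA R (scaling a `p`-adic level).**  Along the family obtained by multiplying the top-level coordinates by `p^t`, the kernel is
`c + N·s` with `s = p^{−t} ∈ (0, s₀]`; an affine function on `(0, s₀]` is bounded by the larger of its value at `s₀` (lowest admissible
level) and its limit `c` (`s → 0`: the coordinates sent to infinity).  Iterating: maximisers may be taken with chain-valid valuations.
research route conditional on HC_CM; not a corollary; Q11.4-sentence-2 already refuted in dim ≥ 3. [folklore] -/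
theorem affine_family_sup (c N s s₀ : ℚ) (hs : 0 < s) (hs₀ : s ≤ s₀) : c + N * s ≤ max c (c + N * s₀) := by
  rcases le_or_gt 0 N with hN | hN
  · exact le_max_of_le_right (by nlinarith)
  · exact le_max_of_le_left (by nlinarith)

/-- **LEMMA T′ (the `ξ¹`-coefficient terms are non-positive).**  For a `(k−1)`-sub-tuple with `L = lcm`, `s = s_h(L)`, `s₂ = s_h(L/2)`
(`0 ≤ s₂ ≤ s`: an eigenvalue order dividing `L/2` divides `L`), the admissible divisor patterns are `1^{k−1}` (composition constant
`−(k+1)/2`, weight `s/L`) and "one `2`" (constant `+1/2`, weight `(2s₂ − s)/L` for at most one position, else `0`); the total is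
`≤ −(k/2)·s/L ≤ 0`.  Hence D-terms of degree `ξ¹` through a free coordinate never raise an upper bound.
research route conditional on HC_CM; not a corollary; Q11.4-sentence-2 already refuted in dim ≥ 3. [folklore] -/
theorem dkm1_nonpos (k s s₂ L : ℚ) (hk : 0 ≤ k) (hL : 0 < L) (hs₂ : 0 ≤ s₂) (h : s₂ ≤ s) :
    (-(k + 1) / 2 * s + 1 / 2 * (2 * s₂ - s)) / L ≤ -(k / 2) * s / L ∧ -(k / 2) * s / L ≤ 0 := by
  constructor
  · rw [div_le_div_iff_of_pos_right hL]
    nlinarith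
  · have hs : 0 ≤ s := hs₂.trans h
    have : 0 ≤ k / 2 * s / L := by positivity
    have e : -(k / 2) * s / L = -(k / 2 * s / L) := by ring
    linarith

/-- **LEMMA T (a character average).**  `A_h(d; x_A)` is `(1/o)·Σ_{t in a set of at most o/L_d residues} χ_λ(h^t)` with `|χ| ≤ f`, so
`|A_h| ≤ f/L_d`; in numbers: `|S| ≤ f·M` and `M·L_d ≤ o` give `|S|/o ≤ f/L_d`.
research route conditional on HC_CM; not a corollary; Q11.4-sentence-2 already refuted in dim ≥ 3. [folklore] -/
theorem character_average_bound (S f M o Ld : ℚ) (ho : 0 < o) (hLd : 0 < Ld) (hf : 0 ≤ f) (hS : |S| ≤ f * M) (hM : M * Ld ≤ o) :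
    |S| / o ≤ f / Ld := by
  rw [div_le_div_iff₀ ho hLd]
  calc |S| * Ld ≤ f * M * Ld := mul_le_mul_of_nonneg_right hS hLd.le
    _ = f * (M * Ld) := by ring
    _ ≤ f * o := mul_le_mul_of_nonneg_left hM hf

/-! ### §4 THEOREM J4 — the budget algebra for every `k`, the two-endpoint principle, pure slots -/

/-- **THEOREM J4, the budget algebra (every `k`).**  For a datum with `c` carrier slots (any pure slots being neutral), total fixed
dimension `F = Σ_j Fix_j`, total ramification `U = Σ_j u_j ≥ 2n − 2` (Riemann–Hurwitz), LEMMA K_k summed over the slots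
(`F + T n^{k−1} U ≤ n^k·P`, `P = Σ_j Ψ_{h_j}(T,1/n)`) and the certificate inequality at `ξ = 1/n`, written as
`n^k·S_σ(1/n) = (c−2)·f·d_k + 2T n^{k−1}(n−1) − 6 − n^k P > 0` (`d_k = n^k e_k(1/n)`), give `F < (c−2) f d_k − 6`: the budget (B) fails.
research route conditional on HC_CM; not a corollary; Q11.4-sentence-2 already refuted in dim ≥ 3. [folklore] -/
theorem budget_exclusion_k (k : ℕ) (n f T c P F U dk : ℚ) (hn : 0 ≤ n) (hT : 0 ≤ T)
    (hK : F + T * n ^ (k - 1) * U ≤ n ^ k * P) (hU : 2 * n - 2 ≤ U)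
    (hS : 0 < (c - 2) * f * dk + 2 * T * n ^ (k - 1) * (n - 1) - 6 - n ^ k * P) :
    F < (c - 2) * f * dk - 6 := by
  have h1 : T * n ^ (k - 1) * (2 * n - 2) ≤ T * n ^ (k - 1) * U :=
    mul_le_mul_of_nonneg_left hU (mul_nonneg hT (pow_nonneg hn _))
  nlinarith

/-- **THEOREM J4, the two-endpoint principle (tail `n ≥ n₁`).**  A function concave on `[0, ξ₁]` that is positive at both endpoints is
positive on the whole interval (minimum principle); `S̃_σ(ξ) = (c−2) f ẽ_k(ξ) + 2T(1−ξ) − 6ξ^k − Σ_h Ψ⁺_h(T,ξ)` (the budget polynomial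
with its positive higher coefficients dropped, each kernel polynomial replaced by its `ξ`-convex majorant, then the supremum) is such
a function with `S̃_σ ≤ S_σ`, so `S̃_σ(0) > 0` and `S̃_σ(1/n₁) > 0` give `S_σ(1/n) > 0` for every `n ≥ n₁`.
research route conditional on HC_CM; not a corollary; Q11.4-sentence-2 already refuted in dim ≥ 3. [folklore] -/
theorem two_endpoints_of_concave (φ : ℚ → ℚ) (ξ₁ ξ : ℚ) (hφ : ConcaveOn ℚ (Set.Icc 0 ξ₁) φ) (hξ₁ : 0 ≤ ξ₁)
    (h0 : 0 < φ 0) (h1 : 0 < φ ξ₁) (hξ : ξ ∈ Set.Icc 0 ξ₁) : 0 < φ ξ := by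
  have hmin := hφ.min_le_of_mem_Icc (Set.left_mem_Icc.2 hξ₁) (Set.right_mem_Icc.2 hξ₁) hξ
  exact lt_of_lt_of_le (lt_min h0 h1) hmin

/-- A concave minorant of the budget polynomial: dropping a non-negative higher-order term `C ξ^i` (`C ≥ 0`, `ξ ≥ 0`) only lowers the
value, and `ξ ↦ −C ξ^i` is what remains of the negative ones; so `ẽ_k ≤ e_k` termwise on `ξ ≥ 0`.
research route conditional on HC_CM; not a corollary; Q11.4-sentence-2 already refuted in dim ≥ 3. [folklore] -/
theorem drop_nonneg_term (A C ξ : ℚ) (i : ℕ) (hC : 0 ≤ C) (hξ : 0 ≤ ξ) : A ≤ A + C * ξ ^ i := by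
  have : 0 ≤ C * ξ ^ i := mul_nonneg hC (pow_nonneg hξ _)
  linarith

/-- The `ξ`-convex majorant of a kernel polynomial: replacing a coefficient of degree `i ≥ 2` by its positive part only raises the
value on `ξ ≥ 0` (`c ξ^i ≤ c⁺ ξ^i`), and a polynomial with non-negative coefficients in degrees `≥ 2` is convex there; the supremum
`Ψ⁺_h` of convex functions is convex.
research route conditional on HC_CM; not a corollary; Q11.4-sentence-2 already refuted in dim ≥ 3. [folklore] -/
theorem positive_part_majorant (c ξ : ℚ) (i : ℕ) (hξ : 0 ≤ ξ) : c * ξ ^ i ≤ max c 0 * ξ ^ i :=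
  mul_le_mul_of_nonneg_right (le_max_left c 0) (pow_nonneg hξ _)

/-- **Pure slots (uniform neutrality criterion).**  For a kept tuple `w ≠ 1^k` of the identity label with kernel `Tα + Σ κ_i ξ^i`, the
monotone majorant `M(ξ) = Tα + κ₀ + Σ_{i≥1} κ_i⁺ ξ^i` is non-decreasing on `ξ ≥ 0`; if `M(ξ₀) ≤ f ẽ_k(ξ₀)` and `f ẽ_k` is concave with
`f ẽ_k(0) ≥ f ẽ_k(ξ₀)` (so `f ẽ_k(ξ) ≥ f ẽ_k(ξ₀)` on `[0, ξ₀]`), then `KER_1(w;T,ξ) ≤ M(ξ) ≤ M(ξ₀) ≤ f ẽ_k(ξ₀) ≤ f ẽ_k(ξ) ≤ f e_k(ξ)`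
for every `ξ ∈ [0, ξ₀]`: the pure-slot supremum is attained at `1^k` (value `f e_k(ξ) = f d_k/n^k`) for EVERY `n ≥ 1/ξ₀`, i.e. a pure
slot adds to the bound exactly what it adds to the budget.  The chain of inequalities:
research route conditional on HC_CM; not a corollary; Q11.4-sentence-2 already refuted in dim ≥ 3. [folklore] -/
theorem pure_slot_chain (K M Mξ₀ Eξ₀ Et E : ℚ) (h1 : K ≤ M) (h2 : M ≤ Mξ₀) (h3 : Mξ₀ ≤ Eξ₀) (h4 : Eξ₀ ≤ Et) (h5 : Et ≤ E) :
    K ≤ E :=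
  h1.trans (h2.trans (h3.trans (h4.trans h5)))

/-- The head of a certificate (`n₀ ≤ n < n₁`): for ONE `n` the theorem needs only the single exact inequality `S_σ(1/n; T_n) > 0`
(with pure neutrality at `(T_n, n)`), the multiplier `T_n` being free to depend on `n`; `budget_exclusion_k` is applied per `n`.
The bookkeeping: a statement proved for each `n` of a finite list and for all `n ≥ n₁` holds for all `n ≥ n₀` when the list is
`n₀, …, n₁ − 1`.
research route conditional on HC_CM; not a corollary; Q11.4-sentence-2 already refuted in dim ≥ 3. [folklore] -/
theorem head_and_tail (Q : ℕ → Prop) (n₀ n₁ : ℕ) (hhead : ∀ n, n₀ ≤ n → n < n₁ → Q n) (htail : ∀ n, n₁ ≤ n → Q n) :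
    ∀ n, n₀ ≤ n → Q n := by
  intro n hn
  rcases lt_or_ge n n₁ with h | h
  · exact hhead n hn h
  · exact htail n h

/-! ### §5 LEMMA μ_k for every `k`, and the Euclidean signature in every Johnson window -/

/-- **LEMMA μ_k, the semiregular step.**  A fixed-point-free element of prime order `p` with `a = n/p` cycles has
`codim Fix(g | S^{(n−k,k)}) = ((p−1)/p)·(d_k − χ_k(g))` with `χ_k(g) ≤ C(a, ⌊k/p⌋) ≤ C' := C(⌊n/2⌋, ⌊k/2⌋)`; if `d_k ≥ 2C'` and
`C' ≥ 14` then the codimension is `≥ (d_k − C')/2 ≥ 7`.  (`d_k ≥ 2C'` comes from `C(n,k) ≥ C(⌊n/2⌋,⌊k/2⌋)·C(⌈n/2⌉,⌈k/2⌉)` — one term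
of Vandermonde, in the tree as `Literature.NumberTheory.DiophantineGeometry.choose_mul_choose_le_choose_add` — and `dk_lower`.)
research route conditional on HC_CM; not a corollary; Q11.4-sentence-2 already refuted in dim ≥ 3. [folklore] -/
theorem mu_semiregular_step (p d χ C' : ℚ) (hp : 2 ≤ p) (hχ : χ ≤ C') (hd : 2 * C' ≤ d) (hC : 14 ≤ C') :
    7 ≤ (p - 1) / p * (d - χ) := by
  have hp0 : 0 < p := by linarith
  have h1 : 1 / 2 ≤ (p - 1) / p := by
    rw [div_le_div_iff₀ (by norm_num : (0:ℚ) < 2) hp0]; linarith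
  have h2 : 14 ≤ d - χ := by linarith
  calc (7 : ℚ) = 1 / 2 * 14 := by norm_num
    _ ≤ (p - 1) / p * (d - χ) := mul_le_mul h1 h2 (by norm_num) (by linarith)

/-- **LEMMA μ_k, the binomial step:** `d_k = C(n,k)·(n−2k+1)/(n−k+1) ≥ C(n,k)/(k+1)` for `2k ≤ n`, in the cleared form
`(k+1)(n−2k+1) ≥ n−k+1`.
research route conditional on HC_CM; not a corollary; Q11.4-sentence-2 already refuted in dim ≥ 3. [folklore] -/
theorem dk_lower (n k : ℚ) (hk : 0 ≤ k) (hn : 2 * k ≤ n) : n - k + 1 ≤ (k + 1) * (n - 2 * k + 1) := by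
  nlinarith

/-- **LEMMA μ_k, the branching step:** for `g` with a fixed point, `codim_{(n−k,k)}(g) = codim_{(n−1−k,k)}(g) + codim_{(n−k,k−1)}(g)`
(restriction of a two-row Specht module to a point stabiliser), so a lower bound `7` for the first summand and `0` for the second
propagate.
research route conditional on HC_CM; not a corollary; Q11.4-sentence-2 already refuted in dim ≥ 3. [folklore] -/
theorem mu_branching_step (x y : ℚ) (hx : 7 ≤ x) (hy : 0 ≤ y) : 7 ≤ x + y := by linarith

/-- **The Euclidean signature in EVERY Johnson window.**  For `F₂₁`'s `(3a)³` (eigenvalues `1, ω, ω²`) each slot has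
`codim = 2d_k + δ_j` with deficit `δ_j = codim Fix(y_j³ | S^{(n−k,k)}) ∈ {0} ∪ [μ, ∞)`, pure slots `f·codim Fix(y) ∈ {0} ∪ [μ,∞)`,
and the budget `Σ codim = 2 f d_k + 6 = 6 d_k + 6` forces the deficits to sum to `6`; with `μ ≥ 7` (LEMMA μ_k: `n ≥ 9`, `3 ≤ k ≤ n/2`;
LEMMA μ: `k = 2`, `n ≥ 10`) every deficit vanishes — all `y_j³ = 1`, no pure slot — and the sum is `0 ≠ 6`.  The counting step:
research route conditional on HC_CM; not a corollary; Q11.4-sentence-2 already refuted in dim ≥ 3. [folklore] -/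
theorem tight_signature_all_k {ι : Type*} (s : Finset ι) (δ : ι → ℕ) (h : ∀ j ∈ s, δ j = 0 ∨ 7 ≤ δ j) : ∑ j ∈ s, δ j ≠ 6 := by
  intro h6
  by_cases hall : ∀ j ∈ s, δ j = 0
  · rw [Finset.sum_eq_zero hall] at h6
    exact absurd h6 (by norm_num)
  · push Not at hall
    obtain ⟨j, hj, hne⟩ := hall
    have h7 : 7 ≤ δ j := (h j hj).resolve_left hne
    have hle : δ j ≤ ∑ i ∈ s, δ i := Finset.single_le_sum (fun _ _ => Nat.zero_le _) hj
    omega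

/-! ### §6 The `ξ = 0` endpoint arithmetic of the certificates of record (`lagrk.py`, exact integer branch-and-bound) -/

/-- **`k = 4`, `G₂₄`, signature `(−2, −7a, 3)` (the worst of the carrier's 402 signatures: `n₀ = 13`, tail from `n₁ = 30` at
`T = 35/1152`).**  At `ξ = 0` the kernel maxima are `Ψ_{−2} = KER(1,1,1,1) = e_h/4! = 1/12`,
`Ψ_{−7a} = KER(14,14,14,14) = T·(13/14) + 3/(4!·14) = 599/16128`, `Ψ_3 = KER(3,3,3,3) = T·(2/3) + 3/(4!·3) = 107/1728`;
`S̃(0) = f/4! + 2T − ΣΨ = 163/48384 > 0`.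
research route conditional on HC_CM; not a corollary; Q11.4-sentence-2 already refuted in dim ≥ 3. [folklore] -/
theorem g24_k4_worst_at_zero :
    (35 : ℚ) / 1152 * (13 / 14) + 3 / (24 * 14) = 599 / 16128 ∧ (35 : ℚ) / 1152 * (2 / 3) + 3 / (24 * 3) = 107 / 1728 ∧
    (3 : ℚ) / 24 + 2 * (35 / 1152) - (1 / 12 + 599 / 16128 + 107 / 1728) = 163 / 48384 ∧ (0 : ℚ) < 163 / 48384 := by
  norm_num

/-- **`k = 4`, `GL₂(3)`, signature `(2, 3, 8a)` (worst of the carrier, `n₀ = 15`; tail from `n₁ = 32` at `T = 1/288`):** at `ξ = 0`,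
`Ψ_2 = KER(2,2,2,2) = T/2 + 2/(4!·2) = 25/576`, `Ψ_3 = KER(3,3,3,3) = 2T/3 + 2/(4!·3) = 13/432`, `Ψ_{8a} = KER(8,8,8,8) = 7T/8 + 2/(4!·8)
= 31/2304`; `S̃(0) = 2/4! + 2T − ΣΨ = 23/6912 > 0`.
research route conditional on HC_CM; not a corollary; Q11.4-sentence-2 already refuted in dim ≥ 3. [folklore] -/
theorem gl23_k4_worst_at_zero :
    (1 : ℚ) / 288 * (1 / 2) + 2 / (24 * 2) = 25 / 576 ∧ (1 : ℚ) / 288 * (2 / 3) + 2 / (24 * 3) = 13 / 432 ∧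
    (1 : ℚ) / 288 * (7 / 8) + 2 / (24 * 8) = 31 / 2304 ∧
    (2 : ℚ) / 24 + 2 * (1 / 288) - (25 / 576 + 13 / 432 + 31 / 2304) = 23 / 6912 ∧ (0 : ℚ) < 23 / 6912 := by
  norm_num

/-- **`k = 5`, `G₂₄`, signature `(−2, −3, 7a)` (worst of the carrier at `k = 5`: `n₀ = 16`, tail from `n₁ = 33` at `T = 1/192`):**
at `ξ = 0`, `Ψ_{−2} = e_h/5! = 1/60`, `Ψ_{−3} = KER(6,6,6,6,6) = 5T/6 + 3/(5!·6) = 49/5760`, `Ψ_{7a} = KER(7,…,7) = 6T/7 + 3/(5!·7)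
= 9/1120`; `S̃(0) = 3/5! + 2T − ΣΨ = 89/40320 > 0`.
research route conditional on HC_CM; not a corollary; Q11.4-sentence-2 already refuted in dim ≥ 3. [folklore] -/
theorem g24_k5_worst_at_zero :
    (1 : ℚ) / 192 * (5 / 6) + 3 / (120 * 6) = 49 / 5760 ∧ (1 : ℚ) / 192 * (6 / 7) + 3 / (120 * 7) = 9 / 1120 ∧
    (3 : ℚ) / 120 + 2 * (1 / 192) - (1 / 60 + 49 / 5760 + 9 / 1120) = 89 / 40320 ∧ (0 : ℚ) < 89 / 40320 := by
  norm_num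

/-- **`k = 5`, `PSL₂(11) = η₅`, the Hurwitz-type signature `(11a, 2A, 3A)` (`n₀ = 16`, tail from `n₁ = 44` at `T = 5/864`):** at
`ξ = 0`, `Ψ_{11a} = KER(11,…,11) = 10T/11 + 5/(5!·11) = 43/4752`, `Ψ_{2A} = e_h/5! = 3/120 = 1/40`, `Ψ_{3A} = 2T/3 + 5/(5!·3) = 23/1296`;
`S̃(0) = 5/5! + 2T − ΣΨ = 103/71280 > 0`.
research route conditional on HC_CM; not a corollary; Q11.4-sentence-2 already refuted in dim ≥ 3. [folklore] -/
theorem eta5_k5_hurwitz_type_at_zero :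
    (5 : ℚ) / 864 * (10 / 11) + 5 / (120 * 11) = 43 / 4752 ∧ (5 : ℚ) / 864 * (2 / 3) + 5 / (120 * 3) = 23 / 1296 ∧
    (5 : ℚ) / 120 + 2 * (5 / 864) - (43 / 4752 + 1 / 40 + 23 / 1296) = 103 / 71280 ∧ (0 : ℚ) < 103 / 71280 := by
  norm_num

/-- **`G₂₄`, all `c ≥ 5` multisets at once, `k = 4` (`T = 29/1152`, from `n = 12`) and `k = 5` (`T = 29/5760`, from `n = 16`), `ξ = 0`:**
`δ_min = f/k! − Ψ_{−2}(T,0) = (f − e_{−2})/k!` (`= 1/24`, `1/120`), `D(0) = 2f/k! − 2T` (`= 115/576`, `23/576`), and `5δ_min − D > 0`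
(`= 5/576`, `1/576`).
research route conditional on HC_CM; not a corollary; Q11.4-sentence-2 already refuted in dim ≥ 3. [folklore] -/
theorem g24_five_slots_k4_k5 :
    (3 : ℚ) / 24 - 2 / 24 = 1 / 24 ∧ (2 : ℚ) * 3 / 24 - 2 * (29 / 1152) = 115 / 576 ∧ (5 : ℚ) * (1 / 24) - 115 / 576 = 5 / 576 ∧
    (3 : ℚ) / 120 - 2 / 120 = 1 / 120 ∧ (2 : ℚ) * 3 / 120 - 2 * (29 / 5760) = 23 / 576 ∧ (5 : ℚ) * (1 / 120) - 23 / 576 = 1 / 576 := by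
  norm_num

/-- **The Euclidean multisets stay Euclidean for every `k`:** at `ξ = 0` the certificate of `F₂₁`'s `(3a)³` reads
`sup_T [f/k! + 2T − 3·Ψ_{3a}(T,0)]` with `Ψ_{3a}(T,0) ≥ KER(3,…,3) = 2T/3 + 3/(k!·3)`, identically `≤ 0` (here `kf = k!`):
the Lagrangian bound cannot touch it, and LEMMA μ_k (§5) takes over, as THEOREM J2 (iii) did at `k = 2`.
research route conditional on HC_CM; not a corollary; Q11.4-sentence-2 already refuted in dim ≥ 3. [folklore] -/
theorem euclidean_signature_every_k (kf T : ℚ) (hk : 0 < kf) : 3 / kf + 2 * T - 3 * (2 * T / 3 + 3 / (kf * 3)) = 0 := by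
  field_simp
  ring

end LagrangianJohnsonWindows

end Summit.HodgeConjecture.HodgeConjecture.Ring2.WeilCoverage

end
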